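import Summits.QuantumAdvantage.QuantumAdvantage.Theorems.CubicForrelationNearExactIsExactTwelveLevelSixRigidPack200

/-!
# Crux `CubicForrelation.NearExactIsExact` (stmt-QuantumAdvantage-14043) — n = 12, level ≥ 6 AT `Φ = 934/1024`: packaging the RIGID off-flat
  configurations at off-flat energy `≤ 208` (`≥ 48` points of cost `≥ 4`, at most `16` to spare — one exceptional point)

Certificate seat `b2b-cforr-cert` (gen 18).  HONEST FRAMING: elementary bookkeeping (standard axioms) for the level-`≥ 6` branch of "is `934/1024`
attained at `n = 12`?"; NOT summit progress.

`tw18_rigid_pack208`: if `48` or more points `U` off `Z`, each with `e² = 4` or `e² ≥ 16`, lie in three given cosets, every other point off `Z`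
has `e = 0` or `e² ≥ 16`, every point off `Z` outside the three cosets with `8 ∤ e` comes with `8` points off `Z` outside the cosets of cost
`≥ 16` each (round 2 of the off-flat analysis), and the off-flat energy is `≤ 208`, then the set `Ω = {y ∉ Z : 8 ∤ e(y)}` lies in the three
cosets, `#Ω ≤ 52`, `e² = 4` on `Ω` except at most ONE point, and the energy is `≥ 192`.  (`tw18_rigid_pack200` is the case `≤ 200`, where
no exceptional point occurs.)
-/

set_option linter.dupNamespace false -- D-0017: single-problem summit ⇒ `QuantumAdvantage.QuantumAdvantage` by design

noncomputable section

namespace Summit.QuantumAdvantage.QuantumAdvantage.Theorems.CubicForrelation.NearExactIsExact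

open Finset

/-- **Rigid packaging at off-flat energy `≤ 208`.**  See the module docstring. [this work] -/
theorem tw18_rigid_pack208 {α : Type*} [DecidableEq α] [Fintype α] (e : α → ℤ) (Z U C₁ C₂ C₃ : Finset α)
    (hUZ : ∀ x ∈ U, x ∉ Z) (hU4 : ∀ x ∈ U, e x ^ 2 = 4 ∨ 16 ≤ e x ^ 2) (hU48 : 48 ≤ #U) (hUC : ∀ x ∈ U, x ∈ C₁ ∨ x ∈ C₂ ∨ x ∈ C₃)
    (hout : ∀ x, x ∉ Z → x ∉ U → e x = 0 ∨ 16 ≤ e x ^ 2)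
    (hfar : ∀ x, x ∉ Z → ¬ (x ∈ C₁ ∨ x ∈ C₂ ∨ x ∈ C₃) → ¬ (8 : ℤ) ∣ e x →
      ∃ T : Finset α, 8 ≤ #T ∧ (∀ y ∈ T, y ∉ Z ∧ ¬ (y ∈ C₁ ∨ y ∈ C₂ ∨ y ∈ C₃)) ∧ ∀ y ∈ T, 16 ≤ e y ^ 2)
    (hoff_le : ∑ x ∈ univ.filter (fun x => x ∉ Z), e x ^ 2 ≤ 208) :
    (∀ ω ∈ univ.filter (fun ω => ω ∉ Z ∧ ¬ (8 : ℤ) ∣ e ω), ω ∈ C₁ ∨ ω ∈ C₂ ∨ ω ∈ C₃) ∧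
    #(univ.filter (fun ω => ω ∉ Z ∧ ¬ (8 : ℤ) ∣ e ω)) ≤ 52 ∧
    (∃ ω₄ : α, ∀ ω ∈ univ.filter (fun ω => ω ∉ Z ∧ ¬ (8 : ℤ) ∣ e ω), e ω ^ 2 = 4 ∨ ω = ω₄) ∧
    192 ≤ ∑ x ∈ univ.filter (fun x => x ∉ Z), e x ^ 2 := by
  classical
  have hUsub : U ⊆ univ.filter (fun x => x ∉ Z) := fun x hx => mem_filter.2 ⟨mem_univ _, hUZ x hx⟩
  have hU4' : ∀ x ∈ U, 4 ≤ e x ^ 2 := fun x hx => by rcases hU4 x hx with h | h <;> linarith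
  have hUsum_ge : 4 * (#U : ℤ) ≤ ∑ x ∈ U, e x ^ 2 := by
    have h := sum_le_sum hU4'
    rw [sum_const, nsmul_eq_mul] at h
    linarith
  have hsplit := sum_filter_add_sum_filter_not (univ.filter fun x => x ∉ Z) (fun x => x ∈ U) (fun x => e x ^ 2)
  have e1 : (univ.filter fun x : α => x ∉ Z).filter (fun x => x ∈ U) = U := by
    ext y; simp only [mem_filter, mem_univ, true_and]; exact ⟨fun h => h.2, fun h => ⟨hUZ y h, h⟩⟩
  rw [e1] at hsplit
  set Rest := (univ.filter fun x : α => x ∉ Z).filter (fun x => x ∉ U) with hRest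
  have hrest_nn : 0 ≤ ∑ x ∈ Rest, e x ^ 2 := sum_nonneg fun y _ => sq_nonneg (e y)
  have hU48' : (48 : ℤ) ≤ #U := by exact_mod_cast hU48
  have hrest16 : ∑ x ∈ Rest, e x ^ 2 ≤ 16 := by linarith
  -- far points have `8 ∣ e`
  have hfar8 : ∀ x, x ∉ Z → ¬ (x ∈ C₁ ∨ x ∈ C₂ ∨ x ∈ C₃) → (8 : ℤ) ∣ e x := by
    intro x hxZ hxC
    by_contra h8
    obtain ⟨T, hT8, hTfar, hT16⟩ := hfar x hxZ hxC h8
    have hTsub : T ⊆ Rest := fun y hy =>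
      mem_filter.2 ⟨mem_filter.2 ⟨mem_univ _, (hTfar y hy).1⟩, fun hyU => (hTfar y hy).2 (hUC y hyU)⟩
    have h1 : ∑ y ∈ T, (16 : ℤ) ≤ ∑ y ∈ T, e y ^ 2 := sum_le_sum hT16
    rw [sum_const, nsmul_eq_mul] at h1
    have h2 := sum_le_sum_of_subset_of_nonneg hTsub (f := fun y => e y ^ 2) fun y _ _ => sq_nonneg _
    have hT8' : (8 : ℤ) ≤ #T := by exact_mod_cast hT8
    linarith
  have hΩC : ∀ ω ∈ univ.filter (fun ω => ω ∉ Z ∧ ¬ (8 : ℤ) ∣ e ω), ω ∈ C₁ ∨ ω ∈ C₂ ∨ ω ∈ C₃ := by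
    intro ω hω
    obtain ⟨hωZ, hω8⟩ := (mem_filter.1 hω).2
    by_contra hC
    exact hω8 (hfar8 ω hωZ hC)
  -- counting: `#U + #R ≤ 52` where `R` = the other points off `Z` with `e ≠ 0`
  set R := Rest.filter (fun x => e x ≠ 0) with hR
  have hR16 : ∀ x ∈ R, 16 ≤ e x ^ 2 := by
    intro x hx
    have hx1 := (mem_filter.1 hx).1
    rcases hout x (mem_filter.1 (mem_filter.1 hx1).1).2 (mem_filter.1 hx1).2 with h0 | h16
    · exact absurd h0 (mem_filter.1 hx).2
    · exact h16
  have hRsum : 16 * (#R : ℤ) ≤ ∑ x ∈ Rest, e x ^ 2 := by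
    have h1 : ∑ x ∈ R, (16 : ℤ) ≤ ∑ x ∈ R, e x ^ 2 := sum_le_sum hR16
    rw [sum_const, nsmul_eq_mul] at h1
    have h2 := sum_le_sum_of_subset_of_nonneg (filter_subset _ Rest : R ⊆ Rest) (f := fun y => e y ^ 2) fun y _ _ => sq_nonneg _
    linarith
  have hUR : #U + #R ≤ 52 := by
    have : 4 * (#U : ℤ) + 16 * #R ≤ 208 := by linarith
    have : (#U : ℤ) + #R ≤ 52 := by linarith [Int.natCast_nonneg #R]
    exact_mod_cast this
  have hΩsub : univ.filter (fun ω => ω ∉ Z ∧ ¬ (8 : ℤ) ∣ e ω) ⊆ U ∪ R := by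
    intro ω hω
    obtain ⟨hωZ, hω8⟩ := (mem_filter.1 hω).2
    by_cases hωU : ω ∈ U
    · exact mem_union.2 (Or.inl hωU)
    · refine mem_union.2 (Or.inr (mem_filter.2 ⟨mem_filter.2 ⟨mem_filter.2 ⟨mem_univ _, hωZ⟩, hωU⟩, fun h0 => hω8 ?_⟩))
      rw [h0]; exact dvd_zero _
  have hΩcard : #(univ.filter (fun ω => ω ∉ Z ∧ ¬ (8 : ℤ) ∣ e ω)) ≤ 52 :=
    ((card_le_card hΩsub).trans (card_union_le _ _)).trans hUR
  -- at most one exceptional point: the excess over the baseline `4·1_U` is `≤ 16`, and an exceptional point has excess `≥ 12`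
  set ex : α → ℤ := fun x => e x ^ 2 - (if x ∈ U then 4 else 0) with hex
  have hexsum : ∑ x ∈ univ.filter (fun x => x ∉ Z), ex x ≤ 16 := by
    have h1 : ∑ x ∈ univ.filter (fun x => x ∉ Z), ex x =
        ∑ x ∈ univ.filter (fun x => x ∉ Z), e x ^ 2 - ∑ x ∈ univ.filter (fun x => x ∉ Z), (if x ∈ U then (4 : ℤ) else 0) := by
      rw [← sum_sub_distrib]
    have h2 : ∑ x ∈ univ.filter (fun x => x ∉ Z), (if x ∈ U then (4 : ℤ) else 0) = 4 * #U := by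
      rw [← sum_filter, e1, sum_const, nsmul_eq_mul, mul_comm]
    rw [h1, h2]
    linarith
  have hexnn : ∀ x ∈ univ.filter (fun x => x ∉ Z), 0 ≤ ex x := by
    intro x _
    simp only [ex]
    by_cases hxU : x ∈ U
    · rw [if_pos hxU]; linarith [hU4' x hxU]
    · rw [if_neg hxU]; linarith [sq_nonneg (e x)]
  have hexbig : ∀ x, x ∉ Z → e x ≠ 0 → e x ^ 2 ≠ 4 → 12 ≤ ex x := by
    intro x hxZ hne h4
    simp only [ex]
    by_cases hxU : x ∈ U
    · rw [if_pos hxU]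
      rcases hU4 x hxU with h | h
      · exact absurd h h4
      · linarith
    · rw [if_neg hxU]
      rcases hout x hxZ hxU with h | h
      · exact absurd h hne
      · linarith
  have huniq : ∀ x₁ x₂, x₁ ∉ Z → e x₁ ≠ 0 → e x₁ ^ 2 ≠ 4 → x₂ ∉ Z → e x₂ ≠ 0 → e x₂ ^ 2 ≠ 4 → x₁ = x₂ := by
    intro x₁ x₂ h1Z h1e h14 h2Z h2e h24
    by_contra hne
    have hsub : ({x₁, x₂} : Finset α) ⊆ univ.filter (fun x => x ∉ Z) := by
      intro y hy
      rcases mem_insert.1 hy with rfl | hy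
      · exact mem_filter.2 ⟨mem_univ _, h1Z⟩
      · rw [mem_singleton.1 hy]; exact mem_filter.2 ⟨mem_univ _, h2Z⟩
    have h := sum_le_sum_of_subset_of_nonneg hsub (f := ex) fun y hy _ => hexnn y hy
    rw [sum_pair hne] at h
    linarith [hexbig x₁ h1Z h1e h14, hexbig x₂ h2Z h2e h24]
  have hne0 : ∀ ω ∈ univ.filter (fun ω => ω ∉ Z ∧ ¬ (8 : ℤ) ∣ e ω), e ω ≠ 0 := by
    intro ω hω h0
    exact (mem_filter.1 hω).2.2 (by rw [h0]; exact dvd_zero _)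
  refine ⟨hΩC, hΩcard, ?_, ?_⟩
  · by_cases hX : ∃ ω ∈ univ.filter (fun ω => ω ∉ Z ∧ ¬ (8 : ℤ) ∣ e ω), e ω ^ 2 ≠ 4
    · obtain ⟨ω₄, hω₄, hω₄4⟩ := hX
      refine ⟨ω₄, fun ω hω => ?_⟩
      by_cases h4 : e ω ^ 2 = 4
      · exact Or.inl h4
      · exact Or.inr (huniq ω ω₄ (mem_filter.1 hω).2.1 (hne0 ω hω) h4 (mem_filter.1 hω₄).2.1 (hne0 ω₄ hω₄) hω₄4)
    · push Not at hX
      obtain ⟨u₀, -⟩ := card_pos.1 (show 0 < #U by omega)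
      exact ⟨u₀, fun ω hω => Or.inl (hX ω hω)⟩
  · have hUle' : ∑ x ∈ U, e x ^ 2 ≤ ∑ x ∈ univ.filter (fun x => x ∉ Z), e x ^ 2 :=
      sum_le_sum_of_subset_of_nonneg hUsub fun x _ _ => sq_nonneg _
    linarith

end Summit.QuantumAdvantage.QuantumAdvantage.Theorems.CubicForrelation.NearExactIsExact

end
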